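import Literature.NumberTheory.Transcendental.RoySmallValueOrbitLiouville
import HarnessLib

/-!
# Roy's small value estimate for `𝔾ₐ × 𝔾ₘ` — integer forms that are small on a selected orbit vanish on it

Topic `Literature/NumberTheory/Transcendental`. Part of the formalisation of the proof of Roy 2013,
Theorem 1.1 (named fact `roy2013_thm_1_1`, `RoySmallValueEstimates.lean`), seat B. Source: D. Roy,
*A small value estimate for `𝔾ₐ × 𝔾ₘ`*, Mathematika 59 (2013) 333–363 = arXiv:1301.0663,
Proposition 2.4 (p. 7) and the proof of Proposition 6.4 (p. 17):

> **Proposition 2.4.** Let `Z` be a zero-dimensional subvariety of `ℙ^m_ℚ` and `𝒞` a convex body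
> of `ℂ[X]_D`. Suppose that there exists `P ∈ ℤ[X]_D ∩ 𝒞` which does not belong to the ideal of
> `Z`. Then `h_𝒞(Z) ≥ −6 log(m+1) D deg(Z) − 2D h(Z)`. [...]
> (proof of 6.4) [...] By Proposition 2.4, this means that `Z` is contained in `𝒵(𝒞)`, in
> particular in `𝒵(𝒟ⁱP ; 0 ≤ i < 2T)`.

In this development "`h_𝒞(Z)` very negative" is the output of the orbit selection
(`RoySmallValueOrbitSelection`): a bound `∑_{j∈O} log(|R_j(α_j)|/‖α_j‖^D) ≤ −X` valid for every
family `(R_j)_{j∈O}` of admissible tests. Taking the CONSTANT family `R_j = R` for an integer form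
`R ∈ ℤ[X]_D` with admissible complexification and comparing with Liouville's inequality on the orbit
(`ZeroConfigK.orbit_liouville_log'`: `0 ≤ D h(O) + ∑_{j∈O} log(|R(α_j)|/‖α_j‖^D)` if
`R(α_{i₀}) ≠ 0`) shows: **if `X > D h(O)` then `R` vanishes at every point of the orbit**
(`ZeroConfigK.aeval_eq_zero_of_orbit_bound`). Everything is proved; no definitions, no named
facts.

## References

* [Roy2013] D. Roy, *A small value estimate for 𝔾ₐ × 𝔾ₘ*, Mathematika 59 (2013), 333–363
  (arXiv:1301.0663), Proposition 2.4 and §6, proof of Proposition 6.4 ("`Z ⊆ 𝒵(𝒞)`").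
-/

noncomputable section

open MvPolynomial Finset Height

namespace Literature.NumberTheory.Transcendental

namespace Roy2013

namespace ZeroConfigK

variable {K : IntermediateField ℚ ℂ} {ι : Type*} [Fintype ι] [DecidableEq ι] (Z : ZeroConfigK K ι)
  [Normal ℚ K] [NumberField K]

/-- **Integer forms small on the selected orbit vanish on it** (Roy's Prop. 2.4 ⇒ `Z ⊆ 𝒵(𝒞)`).
`ok` is the admissibility predicate on complex forms (membership in `𝒞`); the hypothesis `hO` is
the orbit bound for constant families; `hX` says the bound beats `D h(O)`,
`h(O) = ∑_{j∈O} h_K(rep j)/[K:ℚ]`. [cite: Roy2013, Proposition 2.4; §6, proof of Prop. 6.4] -/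
theorem aeval_eq_zero_of_orbit_bound (i₀ : ι) (ok : CX → Prop) {D : ℕ} {X : ℝ}
    (hO : ∀ R : CX, ok R →
      ∑ j ∈ Z.orb i₀, Real.log (‖aeval (Z.α j) R‖ / ‖Z.α j‖ ^ D) ≤ -X)
    (hX : (D : ℝ) * ((∑ j ∈ Z.orb i₀, logHeight (Z.rep j)) / Module.finrank ℚ K) < X)
    {R : MvPolynomial (Fin 3) ℤ} (hR : R.IsHomogeneous D) (hok : ok (map (Int.castRingHom ℂ) R)) :
    ∀ j ∈ Z.orb i₀, aeval (Z.α j) (map (Int.castRingHom ℂ) R) = 0 := by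
  -- it suffices to treat one point of the orbit: all points of `orb i₀` have the same orbit
  suffices key : ∀ i, Z.orb i = Z.orb i₀ → aeval (Z.α i) (map (Int.castRingHom ℂ) R) = 0 by
    intro j hj
    refine key j ?_
    -- `orb j = orb i₀` for `j ∈ orb i₀`
    obtain ⟨-, g, rfl⟩ := mem_filter.mp hj
    ext k
    simp only [ZeroConfigK.orb, mem_filter, mem_univ, true_and]
    constructor
    · rintro ⟨h, rfl⟩
      exact ⟨h * g, Z.perm_mul h g i₀⟩
    · rintro ⟨h, rfl⟩
      refine ⟨h * g⁻¹, ?_⟩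
      rw [Z.perm_mul, ← Z.perm_mul g⁻¹ g, inv_mul_cancel, Z.perm_one]
  intro i hi
  by_contra hne
  -- the value at the `K`-representative is non-zero
  have hne' : aeval (Z.rep i) R ≠ 0 := by
    intro h0
    apply hne
    have h1 := Z.coe_aeval_rep_int i R
    rw [h0] at h1
    have h2 : aeval (Z.α i) (map (Int.castRingHom ℂ) R) = aeval (Z.α i) R := by
      rw [← algebraMap_int_eq, aeval_map_algebraMap]
    rw [h2, ← h1]; rfl
  -- Liouville on the orbit of `i` (= orbit of `i₀`)
  have hL := Z.orbit_liouville_log' i hR hne'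
  rw [hi] at hL
  -- the orbit bound for the constant family
  have hB := hO (map (Int.castRingHom ℂ) R) hok
  have hvals : ∀ j, ‖aeval (Z.α j) (map (Int.castRingHom ℂ) R)‖ = ‖aeval (Z.α j) R‖ := fun j => by
    rw [← algebraMap_int_eq, aeval_map_algebraMap]
  simp only [hvals] at hB
  linarith

end ZeroConfigK

end Roy2013

end Literature.NumberTheory.Transcendental
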